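import Summits.AnomalousDissipation.AnomalousDissipation.Theorems.SolenoidalFractalHomogenisationLagrangianCarrierConstructionTowerStepA
import Summits.AnomalousDissipation.AnomalousDissipation.Theorems.SolenoidalFractalHomogenisationLagrangianCarrierConstructionTowerStepB
import Summits.AnomalousDissipation.AnomalousDissipation.Theorems.SolenoidalFractalHomogenisationLagrangianCarrierConstructionTowerStepC
import HarnessLib

/-!
# K3L `LagrangianCarrierConstruction` (stmt-AnomalousDissipation-24913), line `birth`, stub `stub_flowsL`:
# the inductive step of the Lagrangian tower, IV — assembly (helper; `--supports stmt-AnomalousDissipation-24913`)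

Summits-side helper file (everything proved; no definitions, no named facts). `tower_step`: given the absolute flow
`A t : ℝ^d ≃ ℝ^d` of the coarse Lagrangian levels with its velocity `B` and break times `D` satisfying the TOWER INVARIANT
(lattice equivariance; one-sided joint `C¹` slabs of `(t,z) ↦ A t z` and of the inverses at every time, two-sided ones off the
countable `D`; the flow equation `∂ₜ A t z = B t (A t z)` off `D`; `B` periodic, locally bounded, jointly continuous off
`D`; derivative bounds on compact time ranges), the next Eulerian level field `v` (Cauchy–Lipschitz on `ℝ`, lattice
periodic, `C¹` on one-sided time slabs, bounded) and its refresh window length `R > 0`, there is a next absolute flow `A'`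
with break times `D' ⊇ D` satisfying the same invariant with the velocity
`B' t = B t + D(X(t, w)) ∘ X(w, t) · v t ∘ X(w, t)`, `X(t, s) = A t ∘ A s⁻¹`, `w = ⌊t/R⌋R`
— the coarse velocity plus the Eulerian level PUSHED FORWARD by the coarse flow from the left end of the current refresh
window (Armstrong–Vicol's Lagrangian insertion, arXiv:2305.05048 §2.2). Construction: `A' t = A t ∘ A w⁻¹ ∘ φ(t, w) ∘ C ⌊t/R⌋`
with the accumulated window maps `C` (`…TowerStepA`), smoothness from `…TowerStepB`, the flow equation and the inserted
velocity from `…TowerStepC`. Infrastructure for the construction side of route-1's rung leaf F-D1.A0 (a frontier formal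
rung); NOT a proof of anomalous dissipation.
-/

set_option linter.dupNamespace false

noncomputable section

namespace Summit.AnomalousDissipation.AnomalousDissipation.Theorems.SolenoidalFractalHomogenisation.LagrangianCarrierConstruction

open Set Function Filter Topology Metric
open scoped NNReal
open Literature.Analysis.ODE Literature.Analysis.FunctionSpaces

section Aux

variable {V : Type*} [NormedAddCommGroup V] [NormedSpace ℝ V]

/-- A slice of a map that is jointly `C¹` on a slab containing the time is `C¹`. [folklore] -/
theorem contDiff_slice_of_slab {Φ : ℝ × V → V} {S : Set ℝ} {t : ℝ} (ht : t ∈ S)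
    (h : ContDiffOn ℝ 1 Φ (S ×ˢ univ)) : ContDiff ℝ 1 fun z => Φ (t, z) :=
  h.comp_contDiff (contDiff_const.prodMk contDiff_id) fun _ => ⟨ht, mem_univ _⟩

/-- Derivative bound for a fourfold composition of `C¹` maps. [folklore] -/
theorem norm_fderiv_comp4_le (G₁ G₂ G₃ G₄ : V → V) (h₁ : ContDiff ℝ 1 G₁) (h₂ : ContDiff ℝ 1 G₂) (h₃ : ContDiff ℝ 1 G₃)
    (h₄ : ContDiff ℝ 1 G₄) {K₁ K₂ K₃ K₄ : ℝ} (hK₁ : ∀ y, ‖fderiv ℝ G₁ y‖ ≤ K₁) (hK₂ : ∀ y, ‖fderiv ℝ G₂ y‖ ≤ K₂)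
    (hK₃ : ∀ y, ‖fderiv ℝ G₃ y‖ ≤ K₃) (hK₄ : ∀ y, ‖fderiv ℝ G₄ y‖ ≤ K₄) (n₁ : 0 ≤ K₁) (n₂ : 0 ≤ K₂) (n₃ : 0 ≤ K₃)
    (z : V) : ‖fderiv ℝ (fun y => G₁ (G₂ (G₃ (G₄ y)))) z‖ ≤ K₁ * K₂ * K₃ * K₄ := by
  have d₁ := h₁.differentiable (by simp); have d₂ := h₂.differentiable (by simp)
  have d₃ := h₃.differentiable (by simp); have d₄ := h₄.differentiable (by simp)
  have e1 : fderiv ℝ (fun y => G₁ (G₂ (G₃ (G₄ y)))) z =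
      (fderiv ℝ G₁ (G₂ (G₃ (G₄ z)))).comp (fderiv ℝ (fun y => G₂ (G₃ (G₄ y))) z) :=
    fderiv_comp z (d₁ _) ((d₂ _).comp z ((d₃ _).comp z (d₄ _)))
  have e2 : fderiv ℝ (fun y => G₂ (G₃ (G₄ y))) z = (fderiv ℝ G₂ (G₃ (G₄ z))).comp (fderiv ℝ (fun y => G₃ (G₄ y)) z) :=
    fderiv_comp z (d₂ _) ((d₃ _).comp z (d₄ _))
  have e3 : fderiv ℝ (fun y => G₃ (G₄ y)) z = (fderiv ℝ G₃ (G₄ z)).comp (fderiv ℝ G₄ z) := fderiv_comp z (d₃ _) (d₄ _)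
  rw [e1, e2, e3]
  calc ‖(fderiv ℝ G₁ (G₂ (G₃ (G₄ z)))).comp ((fderiv ℝ G₂ (G₃ (G₄ z))).comp ((fderiv ℝ G₃ (G₄ z)).comp (fderiv ℝ G₄ z)))‖
      ≤ ‖fderiv ℝ G₁ (G₂ (G₃ (G₄ z)))‖ * (‖fderiv ℝ G₂ (G₃ (G₄ z))‖ * (‖fderiv ℝ G₃ (G₄ z)‖ * ‖fderiv ℝ G₄ z‖)) := by
        refine (ContinuousLinearMap.opNorm_comp_le _ _).trans (mul_le_mul_of_nonneg_left ?_ (norm_nonneg _))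
        refine (ContinuousLinearMap.opNorm_comp_le _ _).trans (mul_le_mul_of_nonneg_left ?_ (norm_nonneg _))
        exact ContinuousLinearMap.opNorm_comp_le _ _
    _ ≤ K₁ * (K₂ * (K₃ * K₄)) := by
        refine mul_le_mul (hK₁ _) ?_ (by positivity) n₁
        refine mul_le_mul (hK₂ _) ?_ (by positivity) n₂
        exact mul_le_mul (hK₃ _) (hK₄ _) (norm_nonneg _) n₃
    _ = K₁ * K₂ * K₃ * K₄ := by ring

/-- One-sided slabs at every point give two-sided slabs on punctured neighbourhoods; hence the set of times without a
two-sided smooth slab is countable. [folklore] -/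
theorem countable_not_two_sided {Φ : ℝ × V → V} {n : WithTop ℕ∞}
    (hloc : ∀ r : ℝ, ∃ ε > 0, ContDiffOn ℝ n Φ (Icc r (r + ε) ×ˢ univ) ∧ ContDiffOn ℝ n Φ (Icc (r - ε) r ×ˢ univ)) :
    {t : ℝ | ¬ ∃ ε > 0, ContDiffOn ℝ n Φ (Icc (t - ε) (t + ε) ×ˢ univ)}.Countable := by
  refine countable_setOf_not_of_eventually_punctured fun r => ?_
  obtain ⟨ε, hε, hR, hL⟩ := hloc r
  refine ⟨ε, hε, fun t htr htd => ?_⟩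
  rw [Real.dist_eq, abs_lt] at htd
  rcases lt_or_gt_of_ne htr with hlt | hgt
  · refine ⟨min (r - t) (t - (r - ε)), lt_min (by linarith) (by linarith),
      hL.mono (prod_mono (Icc_subset_Icc ?_ ?_) le_rfl)⟩
    · linarith [min_le_right (r - t) (t - (r - ε))]
    · linarith [min_le_left (r - t) (t - (r - ε))]
  · refine ⟨min (t - r) (r + ε - t), lt_min (by linarith) (by linarith),
      hR.mono (prod_mono (Icc_subset_Icc ?_ ?_) le_rfl)⟩
    · linarith [min_le_left (t - r) (r + ε - t)]
    · linarith [min_le_right (t - r) (r + ε - t)]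

end Aux

section Step

variable {d : Type*} [Fintype d] [DecidableEq d]

/-- **The inductive step of the Lagrangian tower** (see the module docstring). [cite: ArmstrongVicol2025, §2.2 (PDF pp. 12, 18: the Lagrangian flows X_m and the insertion on refresh windows)] -/
theorem tower_step
    (A : ℝ → EuclideanSpace ℝ d ≃ EuclideanSpace ℝ d) (B : ℝ → EuclideanSpace ℝ d → EuclideanSpace ℝ d) (D : Set ℝ)
    (h1 : ∀ t z (k : d → ℤ), A t (z + Torus.latticeVec k) = A t z + Torus.latticeVec k)
    (h3 : ∀ r, ∃ ε > 0, ContDiffOn ℝ 1 (fun p : ℝ × EuclideanSpace ℝ d => A p.1 p.2) (Icc r (r + ε) ×ˢ univ) ∧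
      ContDiffOn ℝ 1 (fun p : ℝ × EuclideanSpace ℝ d => A p.1 p.2) (Icc (r - ε) r ×ˢ univ))
    (h3' : ∀ r, ∃ ε > 0, ContDiffOn ℝ 1 (fun p : ℝ × EuclideanSpace ℝ d => (A p.1).symm p.2) (Icc r (r + ε) ×ˢ univ) ∧
      ContDiffOn ℝ 1 (fun p : ℝ × EuclideanSpace ℝ d => (A p.1).symm p.2) (Icc (r - ε) r ×ˢ univ))
    (h4 : D.Countable)
    (h4a : ∀ t ∉ D, ∃ ε > 0, ContDiffOn ℝ 1 (fun p : ℝ × EuclideanSpace ℝ d => A p.1 p.2) (Icc (t - ε) (t + ε) ×ˢ univ))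
    (h4b : ∀ t ∉ D, ∃ ε > 0, ContDiffOn ℝ 1 (fun p : ℝ × EuclideanSpace ℝ d => (A p.1).symm p.2)
      (Icc (t - ε) (t + ε) ×ˢ univ))
    (h5 : ∀ t ∉ D, ∀ z, HasDerivAt (fun τ => A τ z) (B t (A t z)) t)
    (h7a : ∀ t z (k : d → ℤ), B t (z + Torus.latticeVec k) = B t z)
    (h7b : ∀ a b : ℝ, ∃ C : ℝ, ∀ t ∈ Icc a b, ∀ z, ‖B t z‖ ≤ C)
    (h7c : ∀ t ∉ D, ∀ z, ContinuousAt (uncurry B) (t, z))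
    (h8 : ∀ a b : ℝ, ∃ K : ℝ, ∀ t ∈ Icc a b, ∀ z, ‖fderiv ℝ (A t) z‖ ≤ K)
    (h8' : ∀ a b : ℝ, ∃ K : ℝ, ∀ t ∈ Icc a b, ∀ z, ‖fderiv ℝ (fun y => (A t).symm y) z‖ ≤ K)
    (v : ℝ → EuclideanSpace ℝ d → EuclideanSpace ℝ d) (hv : IsUniformlyLipschitzOn v univ)
    (hvper : ∀ t z (k : d → ℤ), v t (z + Torus.latticeVec k) = v t z)
    (hvloc : ∀ r, ∃ ε > 0, ContDiffOn ℝ 1 (uncurry v) (Icc r (r + ε) ×ˢ univ) ∧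
      ContDiffOn ℝ 1 (uncurry v) (Icc (r - ε) r ×ˢ univ))
    (hvbdd : ∃ C : ℝ, ∀ t z, ‖v t z‖ ≤ C)
    (R : ℝ) (hR : 0 < R) :
    ∃ (A' : ℝ → EuclideanSpace ℝ d ≃ EuclideanSpace ℝ d) (D' : Set ℝ),
    (∀ t z (k : d → ℤ), A' t (z + Torus.latticeVec k) = A' t z + Torus.latticeVec k) ∧
    (∀ r, ∃ ε > 0, ContDiffOn ℝ 1 (fun p : ℝ × EuclideanSpace ℝ d => A' p.1 p.2) (Icc r (r + ε) ×ˢ univ) ∧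
      ContDiffOn ℝ 1 (fun p : ℝ × EuclideanSpace ℝ d => A' p.1 p.2) (Icc (r - ε) r ×ˢ univ)) ∧
    (∀ r, ∃ ε > 0, ContDiffOn ℝ 1 (fun p : ℝ × EuclideanSpace ℝ d => (A' p.1).symm p.2) (Icc r (r + ε) ×ˢ univ) ∧
      ContDiffOn ℝ 1 (fun p : ℝ × EuclideanSpace ℝ d => (A' p.1).symm p.2) (Icc (r - ε) r ×ˢ univ)) ∧
    D'.Countable ∧
    (∀ t ∉ D', ∃ ε > 0, ContDiffOn ℝ 1 (fun p : ℝ × EuclideanSpace ℝ d => A' p.1 p.2) (Icc (t - ε) (t + ε) ×ˢ univ)) ∧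
    (∀ t ∉ D', ∃ ε > 0, ContDiffOn ℝ 1 (fun p : ℝ × EuclideanSpace ℝ d => (A' p.1).symm p.2)
      (Icc (t - ε) (t + ε) ×ˢ univ)) ∧
    (∀ t ∉ D', ∀ z, HasDerivAt (fun τ => A' τ z)
      (B t (A' t z) + fderiv ℝ (fun y => A t ((A ((⌊t / R⌋ : ℝ) * R)).symm y))
        (A ((⌊t / R⌋ : ℝ) * R) ((A t).symm (A' t z))) (v t (A ((⌊t / R⌋ : ℝ) * R) ((A t).symm (A' t z))))) t) ∧
    (∀ t z (k : d → ℤ), (B t (z + Torus.latticeVec k) + fderiv ℝ (fun y => A t ((A ((⌊t / R⌋ : ℝ) * R)).symm y))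
        (A ((⌊t / R⌋ : ℝ) * R) ((A t).symm (z + Torus.latticeVec k)))
        (v t (A ((⌊t / R⌋ : ℝ) * R) ((A t).symm (z + Torus.latticeVec k))))) =
      B t z + fderiv ℝ (fun y => A t ((A ((⌊t / R⌋ : ℝ) * R)).symm y))
        (A ((⌊t / R⌋ : ℝ) * R) ((A t).symm z)) (v t (A ((⌊t / R⌋ : ℝ) * R) ((A t).symm z)))) ∧
    (∀ a b : ℝ, ∃ C : ℝ, ∀ t ∈ Icc a b, ∀ z, ‖B t z + fderiv ℝ (fun y => A t ((A ((⌊t / R⌋ : ℝ) * R)).symm y))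
        (A ((⌊t / R⌋ : ℝ) * R) ((A t).symm z)) (v t (A ((⌊t / R⌋ : ℝ) * R) ((A t).symm z)))‖ ≤ C) ∧
    (∀ t ∉ D', ∀ z, ContinuousAt (uncurry fun t z => B t z + fderiv ℝ (fun y => A t ((A ((⌊t / R⌋ : ℝ) * R)).symm y))
        (A ((⌊t / R⌋ : ℝ) * R) ((A t).symm z)) (v t (A ((⌊t / R⌋ : ℝ) * R) ((A t).symm z)))) (t, z)) ∧
    (∀ a b : ℝ, ∃ K : ℝ, ∀ t ∈ Icc a b, ∀ z, ‖fderiv ℝ (A' t) z‖ ≤ K) ∧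
    (∀ a b : ℝ, ∃ K : ℝ, ∀ t ∈ Icc a b, ∀ z, ‖fderiv ℝ (fun y => (A' t).symm y) z‖ ≤ K) := by
  -- the Eulerian evolution of the new level and the accumulated window maps
  obtain ⟨Z, hZ, hZ'⟩ := exists_flowEquiv hv
  have hZself : ∀ t z, Z t t z = z := fun t z => by rw [hZ, evolutionMap_self]
  obtain ⟨C, hC0, hC⟩ := exists_int_chain fun j : ℤ => (Z (((j : ℝ) + 1) * R) ((j : ℝ) * R)).trans
    ((A ((j : ℝ) * R)).symm.trans (A (((j : ℝ) + 1) * R)))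
  -- basic regularity of the factors
  have hA : ∀ t, ContDiff ℝ 1 (A t) ∧ ContDiff ℝ 1 (A t).symm := fun t => by
    obtain ⟨ε, hε, hR1, -⟩ := h3 t
    obtain ⟨ε', hε', hR2, -⟩ := h3' t
    exact ⟨contDiff_slice_of_slab (Φ := fun p : ℝ × EuclideanSpace ℝ d => A p.1 p.2) (S := Icc t (t + ε))
        ⟨le_rfl, by linarith⟩ hR1,
      contDiff_slice_of_slab (Φ := fun p : ℝ × EuclideanSpace ℝ d => (A p.1).symm p.2) (S := Icc t (t + ε'))
        ⟨le_rfl, by linarith⟩ hR2⟩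
  have hZc : ∀ t s, ContDiff ℝ 1 (Z t s) ∧ ContDiff ℝ 1 (Z t s).symm := fun t s => by
    constructor
    · have e : ⇑(Z t s) = evolutionMap v s t := funext fun z => hZ t s z
      rw [e]; exact contDiff_evolutionMap_of_local hv le_rfl hvloc s t
    · have e : ⇑(Z t s).symm = evolutionMap v t s := funext fun z => hZ' t s z
      rw [e]; exact contDiff_evolutionMap_of_local hv le_rfl hvloc t s
  have hZeq : ∀ t s z (k : d → ℤ), Z t s (z + Torus.latticeVec k) = Z t s z + Torus.latticeVec k :=
    fun t s z k => by rw [hZ, hZ, evolutionMap_add_latticeVec hv hvper]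
  have hMeq : ∀ (j : ℤ) z (k : d → ℤ), ((Z (((j : ℝ) + 1) * R) ((j : ℝ) * R)).trans
      ((A ((j : ℝ) * R)).symm.trans (A (((j : ℝ) + 1) * R)))) (z + Torus.latticeVec k) =
      ((Z (((j : ℝ) + 1) * R) ((j : ℝ) * R)).trans ((A ((j : ℝ) * R)).symm.trans (A (((j : ℝ) + 1) * R)))) z +
        Torus.latticeVec k :=
    fun j z k => equivariant_trans (hZeq _ _) (equivariant_trans (equivariant_symm (h1 _)) (h1 _)) z k
  have hCeq := equivariant_chain C _ hC0 hC hMeq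
  have hCc := contDiff_chain C _ hC0 hC fun j => contDiff_trans (hZc _ _) (contDiff_trans (contDiff_symm (hA _)) (hA _))
  have hvc : Continuous (uncurry v) := by
    have h := hv.continuousOn_uncurry convex_univ
    rw [univ_prod_univ] at h
    exact continuousOn_univ.1 h
  -- the countable set of times without a two-sided smooth slab of `v`
  have hDv : {t : ℝ | ¬ ∃ ε > 0, ContDiffOn ℝ 1 (uncurry v) (Icc (t - ε) (t + ε) ×ˢ univ)}.Countable :=
    countable_not_two_sided hvloc
  -- THE NEW ABSOLUTE FLOW
  refine ⟨fun t => (C ⌊t / R⌋).trans ((Z t ((⌊t / R⌋ : ℝ) * R)).trans ((A ((⌊t / R⌋ : ℝ) * R)).symm.trans (A t))),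
    D ∪ {t : ℝ | ¬ ∃ ε > 0, ContDiffOn ℝ 1 (uncurry v) (Icc (t - ε) (t + ε) ×ˢ univ)} ∪ {t : ℝ | ∃ j : ℤ, t = (j : ℝ) * R},
    ?_, ?_, ?_, ?_, ?_, ?_, ?_, ?_, ?_, ?_, ?_, ?_⟩
  · -- lattice equivariance
    intro t z k
    exact equivariant_window_formula A Z (C ⌊t / R⌋) h1 hZeq (hCeq _) _ _ z k
  · -- one-sided slabs of `A'`
    intro r
    obtain ⟨ε₁, hε₁, hr1⟩ := window_formula_eq_right A Z C R hR hZself hC r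
    obtain ⟨ε₂, hε₂, hr2⟩ := window_formula_eq_left A Z C R hR hZself hC r
    obtain ⟨ε₃, hε₃, hs1, -, -, -⟩ := exists_slabs_window_formula hv hvloc A h3 h3' hA (C ⌊r / R⌋) (hCc _)
      ((⌊r / R⌋ : ℝ) * R) r
    obtain ⟨ε₄, hε₄, -, hs2, -, -⟩ := exists_slabs_window_formula hv hvloc A h3 h3' hA (C (⌈r / R⌉ - 1)) (hCc _)
      (((⌈r / R⌉ - 1 : ℤ) : ℝ) * R) r
    refine ⟨min (min ε₁ ε₂) (min ε₃ ε₄), lt_min (lt_min hε₁ hε₂) (lt_min hε₃ hε₄), ?_, ?_⟩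
    · refine (hs1.mono (prod_mono (Icc_subset_Icc le_rfl (by
        linarith [min_le_right (min ε₁ ε₂) (min ε₃ ε₄), min_le_left ε₃ ε₄])) le_rfl)).congr fun p hp => ?_
      have hp1 : p.1 ∈ Icc r (r + ε₁) := ⟨hp.1.1, le_trans hp.1.2 (by
        linarith [min_le_left (min ε₁ ε₂) (min ε₃ ε₄), min_le_left ε₁ ε₂])⟩
      rw [hr1 p.1 hp1 p.2]
      exact (window_formula_apply A Z (C ⌊r / R⌋) hZ hZ' p.1 _ p.2).1
    · refine (hs2.mono (prod_mono (Icc_subset_Icc (by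
        linarith [min_le_right (min ε₁ ε₂) (min ε₃ ε₄), min_le_right ε₃ ε₄]) le_rfl) le_rfl)).congr fun p hp => ?_
      have hp1 : p.1 ∈ Icc (r - ε₂) r := ⟨le_trans (by
        linarith [min_le_left (min ε₁ ε₂) (min ε₃ ε₄), min_le_right ε₁ ε₂]) hp.1.1, hp.1.2⟩
      rw [hr2 p.1 hp1 p.2]
      exact (window_formula_apply A Z (C (⌈r / R⌉ - 1)) hZ hZ' p.1 _ p.2).1
  · -- one-sided slabs of the inverses
    intro r
    obtain ⟨ε₁, hε₁, hr1⟩ := window_formula_eq_right A Z C R hR hZself hC r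
    obtain ⟨ε₂, hε₂, hr2⟩ := window_formula_eq_left A Z C R hR hZself hC r
    obtain ⟨ε₃, hε₃, -, -, hs1, -⟩ := exists_slabs_window_formula hv hvloc A h3 h3' hA (C ⌊r / R⌋) (hCc _)
      ((⌊r / R⌋ : ℝ) * R) r
    obtain ⟨ε₄, hε₄, -, -, -, hs2⟩ := exists_slabs_window_formula hv hvloc A h3 h3' hA (C (⌈r / R⌉ - 1)) (hCc _)
      (((⌈r / R⌉ - 1 : ℤ) : ℝ) * R) r
    refine ⟨min (min ε₁ ε₂) (min ε₃ ε₄), lt_min (lt_min hε₁ hε₂) (lt_min hε₃ hε₄), ?_, ?_⟩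
    · refine (hs1.mono (prod_mono (Icc_subset_Icc le_rfl (by
        linarith [min_le_right (min ε₁ ε₂) (min ε₃ ε₄), min_le_left ε₃ ε₄])) le_rfl)).congr fun p hp => ?_
      have hp1 : p.1 ∈ Icc r (r + ε₁) := ⟨hp.1.1, le_trans hp.1.2 (by
        linarith [min_le_left (min ε₁ ε₂) (min ε₃ ε₄), min_le_left ε₁ ε₂])⟩
      have hE : (C ⌊p.1 / R⌋).trans ((Z p.1 ((⌊p.1 / R⌋ : ℝ) * R)).trans ((A ((⌊p.1 / R⌋ : ℝ) * R)).symm.trans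
          (A p.1))) = (C ⌊r / R⌋).trans ((Z p.1 ((⌊r / R⌋ : ℝ) * R)).trans ((A ((⌊r / R⌋ : ℝ) * R)).symm.trans
          (A p.1))) := Equiv.ext fun z => hr1 p.1 hp1 z
      simp only []
      rw [hE]
      exact (window_formula_apply A Z (C ⌊r / R⌋) hZ hZ' p.1 _ p.2).2
    · refine (hs2.mono (prod_mono (Icc_subset_Icc (by
        linarith [min_le_right (min ε₁ ε₂) (min ε₃ ε₄), min_le_right ε₃ ε₄]) le_rfl) le_rfl)).congr fun p hp => ?_
      have hp1 : p.1 ∈ Icc (r - ε₂) r := ⟨le_trans (by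
        linarith [min_le_left (min ε₁ ε₂) (min ε₃ ε₄), min_le_right ε₁ ε₂]) hp.1.1, hp.1.2⟩
      have hE : (C ⌊p.1 / R⌋).trans ((Z p.1 ((⌊p.1 / R⌋ : ℝ) * R)).trans ((A ((⌊p.1 / R⌋ : ℝ) * R)).symm.trans
          (A p.1))) = (C (⌈r / R⌉ - 1)).trans ((Z p.1 (((⌈r / R⌉ - 1 : ℤ) : ℝ) * R)).trans
          ((A (((⌈r / R⌉ - 1 : ℤ) : ℝ) * R)).symm.trans (A p.1))) := Equiv.ext fun z => hr2 p.1 hp1 z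
      simp only []
      rw [hE]
      exact (window_formula_apply A Z (C (⌈r / R⌉ - 1)) hZ hZ' p.1 _ p.2).2
  · -- countable break times
    exact (h4.union hDv).union (countable_window_boundaries R)
  · -- two-sided slabs of `A'` off the break times
    intro t ht
    simp only [mem_union, mem_setOf_eq, not_or, not_not] at ht
    obtain ⟨⟨htD, hvt⟩, htb⟩ := ht
    obtain ⟨ε₁, hε₁, hr1⟩ := window_formula_eq_two_sided A Z C R hR hZself hC (t := t) fun j hj => htb ⟨j, hj⟩
    obtain ⟨ε₂, hε₂, hs1, -⟩ := exists_two_sided_slab_window_formula hv hvloc A hA (C ⌊t / R⌋) (hCc _)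
      ((⌊t / R⌋ : ℝ) * R) hvt (h4a t htD) (h4b t htD)
    refine ⟨min ε₁ ε₂, lt_min hε₁ hε₂, (hs1.mono (prod_mono (Icc_subset_Icc (by linarith [min_le_right ε₁ ε₂])
      (by linarith [min_le_right ε₁ ε₂])) le_rfl)).congr fun p hp => ?_⟩
    have hp1 : p.1 ∈ Icc (t - ε₁) (t + ε₁) :=
      ⟨le_trans (by linarith [min_le_left ε₁ ε₂]) hp.1.1, le_trans hp.1.2 (by linarith [min_le_left ε₁ ε₂])⟩
    rw [hr1 p.1 hp1 p.2]
    exact (window_formula_apply A Z (C ⌊t / R⌋) hZ hZ' p.1 _ p.2).1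
  · -- two-sided slabs of the inverses off the break times
    intro t ht
    simp only [mem_union, mem_setOf_eq, not_or, not_not] at ht
    obtain ⟨⟨htD, hvt⟩, htb⟩ := ht
    obtain ⟨ε₁, hε₁, hr1⟩ := window_formula_eq_two_sided A Z C R hR hZself hC (t := t) fun j hj => htb ⟨j, hj⟩
    obtain ⟨ε₂, hε₂, -, hs1⟩ := exists_two_sided_slab_window_formula hv hvloc A hA (C ⌊t / R⌋) (hCc _)
      ((⌊t / R⌋ : ℝ) * R) hvt (h4a t htD) (h4b t htD)
    refine ⟨min ε₁ ε₂, lt_min hε₁ hε₂, (hs1.mono (prod_mono (Icc_subset_Icc (by linarith [min_le_right ε₁ ε₂])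
      (by linarith [min_le_right ε₁ ε₂])) le_rfl)).congr fun p hp => ?_⟩
    have hp1 : p.1 ∈ Icc (t - ε₁) (t + ε₁) :=
      ⟨le_trans (by linarith [min_le_left ε₁ ε₂]) hp.1.1, le_trans hp.1.2 (by linarith [min_le_left ε₁ ε₂])⟩
    have hE : (C ⌊p.1 / R⌋).trans ((Z p.1 ((⌊p.1 / R⌋ : ℝ) * R)).trans ((A ((⌊p.1 / R⌋ : ℝ) * R)).symm.trans
        (A p.1))) = (C ⌊t / R⌋).trans ((Z p.1 ((⌊t / R⌋ : ℝ) * R)).trans ((A ((⌊t / R⌋ : ℝ) * R)).symm.trans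
        (A p.1))) := Equiv.ext fun z => hr1 p.1 hp1 z
    simp only []
    rw [hE]
    exact (window_formula_apply A Z (C ⌊t / R⌋) hZ hZ' p.1 _ p.2).2
  · -- the flow equation off the break times
    intro t ht z
    simp only [mem_union, mem_setOf_eq, not_or, not_not] at ht
    obtain ⟨⟨htD, hvt⟩, htb⟩ := ht
    obtain ⟨ε₁, hε₁, hr1⟩ := window_formula_eq_two_sided A Z C R hR hZself hC (t := t) fun j hj => htb ⟨j, hj⟩
    set s : ℝ := (⌊t / R⌋ : ℝ) * R with hs
    have hder := hasDerivAt_window_formula hv A B s (C ⌊t / R⌋) z (h4a t htD) (h5 t htD) (hA t).1 (hA s).2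
    -- the value of `A' t z` and of the frame point
    have hP : ((C ⌊t / R⌋).trans ((Z t s).trans ((A s).symm.trans (A t)))) z =
        A t ((A s).symm (evolutionMap v s t (C ⌊t / R⌋ z))) := (window_formula_apply A Z (C ⌊t / R⌋) hZ hZ' t s z).1
    have hq : A s ((A t).symm (((C ⌊t / R⌋).trans ((Z t s).trans ((A s).symm.trans (A t)))) z)) =
        evolutionMap v s t (C ⌊t / R⌋ z) := by
      rw [hP]; simp
    simp only []
    rw [hq, hP]
    refine hder.congr_of_eventuallyEq ?_
    filter_upwards [Icc_mem_nhds (show t - ε₁ < t by linarith) (show t < t + ε₁ by linarith)] with τ hτ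
    rw [hr1 τ hτ z]
    exact (window_formula_apply A Z (C ⌊t / R⌋) hZ hZ' τ s z).1
  · -- periodicity of the new velocity
    intro t z k
    rw [h7a, inserted_add_latticeVec A v t _ h1 hvper]
  · -- local boundedness of the new velocity
    intro a b
    obtain ⟨C₀, hC₀⟩ := h7b a b
    obtain ⟨K₁, hK₁⟩ := h8 a b
    obtain ⟨K₂, hK₂⟩ := h8' (a - R) b
    obtain ⟨Cv, hCv⟩ := hvbdd
    refine ⟨C₀ + max K₁ 0 * max K₂ 0 * max Cv 0, fun t ht z => ?_⟩
    have hsI : (⌊t / R⌋ : ℝ) * R ∈ Icc (a - R) b := by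
      obtain ⟨h1', h2'⟩ := floor_window hR t
      exact ⟨by nlinarith [ht.1], le_trans h1' ht.2⟩
    have hb := norm_inserted_le A t ((⌊t / R⌋ : ℝ) * R) (hA t).1 (hA _).2
      (K₁ := max K₁ 0) (K₂ := max K₂ 0) (fun y => (hK₁ t ht y).trans (le_max_left _ _))
      (fun y => (hK₂ _ hsI y).trans (le_max_left _ _)) (le_max_right _ _)
      (A ((⌊t / R⌋ : ℝ) * R) ((A t).symm z)) (v t (A ((⌊t / R⌋ : ℝ) * R) ((A t).symm z)))
    calc _ ≤ ‖B t z‖ + ‖fderiv ℝ (fun y => A t ((A ((⌊t / R⌋ : ℝ) * R)).symm y)) (A ((⌊t / R⌋ : ℝ) * R) ((A t).symm z))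
          (v t (A ((⌊t / R⌋ : ℝ) * R) ((A t).symm z)))‖ := norm_add_le _ _
      _ ≤ C₀ + max K₁ 0 * max K₂ 0 * ‖v t (A ((⌊t / R⌋ : ℝ) * R) ((A t).symm z))‖ := add_le_add (hC₀ t ht z) hb
      _ ≤ C₀ + max K₁ 0 * max K₂ 0 * max Cv 0 := by
          have : ‖v t (A ((⌊t / R⌋ : ℝ) * R) ((A t).symm z))‖ ≤ max Cv 0 := (hCv _ _).trans (le_max_left _ _)
          have h0 : 0 ≤ max K₁ 0 * max K₂ 0 := mul_nonneg (le_max_right _ _) (le_max_right _ _)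
          nlinarith
  · -- joint continuity of the new velocity off the break times
    intro t ht z
    simp only [mem_union, mem_setOf_eq, not_or, not_not] at ht
    obtain ⟨⟨htD, hvt⟩, htb⟩ := ht
    obtain ⟨ε₁, hε₁, hsub⟩ := exists_Icc_subset_Ioo_window hR (t := t) fun j hj => htb ⟨j, hj⟩
    have hB := h7c t htD z
    have hI := continuousAt_inserted A v ((⌊t / R⌋ : ℝ) * R) z (h4a t htD) (h4b t htD) (fun τ => (hA τ).1) (hA _).2 hvc
    refine (hB.add hI).congr ?_
    have hnhds : Icc (t - ε₁) (t + ε₁) ×ˢ (univ : Set (EuclideanSpace ℝ d)) ∈ 𝓝 (t, z) :=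
      prod_mem_nhds (Icc_mem_nhds (by linarith) (by linarith)) univ_mem
    filter_upwards [hnhds] with p hp
    have hfl : ⌊p.1 / R⌋ = ⌊t / R⌋ := floor_eq_of_mem_Ico hR (Ioo_subset_Ico_self (hsub hp.1))
    simp only [Pi.add_apply, uncurry, hfl]
  · -- derivative bounds for `A'` on compact time ranges
    intro a b
    obtain ⟨K₁, hK₁⟩ := h8 a b
    obtain ⟨K₂, hK₂⟩ := h8' (a - R) b
    obtain ⟨K₃, hK₃0, hK₃⟩ := exists_bound_fderiv_evolutionMap_Icc hv (a - R) b
    choose KC hKC using fun j : ℤ => exists_bound_fderiv_of_equivariant (hCc j).1 (hCeq j)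
    refine ⟨max K₁ 0 * max K₂ 0 * K₃ * ∑ j ∈ Finset.Icc ⌊a / R⌋ ⌊b / R⌋, max (KC j) 0, fun t ht z => ?_⟩
    have hsI : (⌊t / R⌋ : ℝ) * R ∈ Icc (a - R) b := by
      obtain ⟨h1', h2'⟩ := floor_window hR t
      exact ⟨by nlinarith [ht.1], le_trans h1' ht.2⟩
    have htI : t ∈ Icc (a - R) b := ⟨by linarith [ht.1], ht.2⟩
    have hjI : ⌊t / R⌋ ∈ Finset.Icc ⌊a / R⌋ ⌊b / R⌋ := by
      rw [Finset.mem_Icc]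
      exact ⟨Int.floor_le_floor (div_le_div_of_nonneg_right ht.1 hR.le),
        Int.floor_le_floor (div_le_div_of_nonneg_right ht.2 hR.le)⟩
    have hKC' : ∀ y, ‖fderiv ℝ (C ⌊t / R⌋) y‖ ≤ ∑ j ∈ Finset.Icc ⌊a / R⌋ ⌊b / R⌋, max (KC j) 0 := fun y =>
      ((hKC _ y).trans (le_max_left _ 0)).trans
        (Finset.single_le_sum (f := fun j => max (KC j) 0) (fun j _ => le_max_right _ _) hjI)
    have e : ⇑((C ⌊t / R⌋).trans ((Z t ((⌊t / R⌋ : ℝ) * R)).trans ((A ((⌊t / R⌋ : ℝ) * R)).symm.trans (A t)))) =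
        fun y => A t ((A ((⌊t / R⌋ : ℝ) * R)).symm (evolutionMap v ((⌊t / R⌋ : ℝ) * R) t (C ⌊t / R⌋ y))) :=
      funext fun y => (window_formula_apply A Z (C ⌊t / R⌋) hZ hZ' t _ y).1
    simp only []
    rw [e]
    exact norm_fderiv_comp4_le (A t) (A ((⌊t / R⌋ : ℝ) * R)).symm (evolutionMap v ((⌊t / R⌋ : ℝ) * R) t)
      (C ⌊t / R⌋) (hA t).1 (hA _).2 (contDiff_evolutionMap_of_local hv le_rfl hvloc _ _) (hCc _).1
      (fun y => (hK₁ t ht y).trans (le_max_left _ _)) (fun y => (hK₂ _ hsI y).trans (le_max_left _ _))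
      (fun y => hK₃ _ hsI _ htI y) hKC' (le_max_right _ _) (le_max_right _ _) hK₃0 z
  · -- derivative bounds for the inverses
    intro a b
    obtain ⟨K₁, hK₁⟩ := h8' a b
    obtain ⟨K₂, hK₂⟩ := h8 (a - R) b
    obtain ⟨K₃, hK₃0, hK₃⟩ := exists_bound_fderiv_evolutionMap_Icc hv (a - R) b
    choose KC hKC using fun j : ℤ => exists_bound_fderiv_of_equivariant (hCc j).2 (equivariant_symm (hCeq j))
    refine ⟨(∑ j ∈ Finset.Icc ⌊a / R⌋ ⌊b / R⌋, max (KC j) 0) * K₃ * max K₂ 0 * max K₁ 0, fun t ht z => ?_⟩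
    have hsI : (⌊t / R⌋ : ℝ) * R ∈ Icc (a - R) b := by
      obtain ⟨h1', h2'⟩ := floor_window hR t
      exact ⟨by nlinarith [ht.1], le_trans h1' ht.2⟩
    have htI : t ∈ Icc (a - R) b := ⟨by linarith [ht.1], ht.2⟩
    have hjI : ⌊t / R⌋ ∈ Finset.Icc ⌊a / R⌋ ⌊b / R⌋ := by
      rw [Finset.mem_Icc]
      exact ⟨Int.floor_le_floor (div_le_div_of_nonneg_right ht.1 hR.le),
        Int.floor_le_floor (div_le_div_of_nonneg_right ht.2 hR.le)⟩
    have hKC' : ∀ y, ‖fderiv ℝ (C ⌊t / R⌋).symm y‖ ≤ ∑ j ∈ Finset.Icc ⌊a / R⌋ ⌊b / R⌋, max (KC j) 0 := fun y =>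
      ((hKC _ y).trans (le_max_left _ 0)).trans
        (Finset.single_le_sum (f := fun j => max (KC j) 0) (fun j _ => le_max_right _ _) hjI)
    have e : (fun y => ((C ⌊t / R⌋).trans ((Z t ((⌊t / R⌋ : ℝ) * R)).trans ((A ((⌊t / R⌋ : ℝ) * R)).symm.trans
        (A t)))).symm y) =
        fun y => (C ⌊t / R⌋).symm (evolutionMap v t ((⌊t / R⌋ : ℝ) * R) (A ((⌊t / R⌋ : ℝ) * R) ((A t).symm y))) :=
      funext fun y => (window_formula_apply A Z (C ⌊t / R⌋) hZ hZ' t _ y).2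
    simp only []
    rw [e]
    have hsum0 : 0 ≤ ∑ j ∈ Finset.Icc ⌊a / R⌋ ⌊b / R⌋, max (KC j) 0 :=
      Finset.sum_nonneg fun j _ => le_max_right _ _
    exact norm_fderiv_comp4_le (C ⌊t / R⌋).symm (evolutionMap v t ((⌊t / R⌋ : ℝ) * R)) (A ((⌊t / R⌋ : ℝ) * R))
      (fun y => (A t).symm y) (hCc _).2 (contDiff_evolutionMap_of_local hv le_rfl hvloc _ _) (hA _).1 (hA t).2
      hKC' (fun y => hK₃ _ htI _ hsI y) (fun y => (hK₂ _ hsI y).trans (le_max_left _ _))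
      (fun y => (hK₁ t ht y).trans (le_max_left _ _)) hsum0 hK₃0 (le_max_right _ _) z

end Step

end Summit.AnomalousDissipation.AnomalousDissipation.Theorems.SolenoidalFractalHomogenisation.LagrangianCarrierConstruction

end
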